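import Mathlib
import Summits.KontsevichZagierPeriods.Zeta5Search.RecordRayCell0910
import Summits.KontsevichZagierPeriods.Zeta5Search.RecordCellAProof
import Summits.KontsevichZagierPeriods.Zeta5Search.AtlasCellRecB
import HarnessLib

/-!
# ζ(5) search — the PATH ACCOUNTING node on Brown–Zudilin's record ray: `PathAccountingFirstPeriod`'s conclusion for `b(n)`, EVERY first-period prime, all `n`

Cell `pub-zeta5` (HONEST FRAMING: systematic search; no irrationality claim unless certified), TRACK «DENOM-LAW» D1 prover seat
(denom-prover-d1 g11, `HOME/denom-law/prover-d1/ATTEMPT-11.md` §8).  The typed D2 node `DenomLaw.PathAccountingFirstPeriod` (Brown–Zudilin (28)+(30)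
transported by `G ≅ S₇`, in Casoratian form: `v_p(Cas₇) ≥ ⌊d/p⌋ − N_p − min([⌊d/p⌋ ≥ 2], 5 − C⋆)`) is proved here ON THE RECORD RAY `b(n) = n·(41;17,…,11)` for
every `n ≥ 1` and EVERY first-period prime `p ≤ 41n` with `p² > 41n + 2` (on the ray the 28 forms are `< 2p` iff `p > 9n`):
* `15n < p` (`pathAccounting_bRec_of_gt15`): `⌊d/p⌋ = ⌊25n/p⌋ ≤ 1` and `C⋆ ≤ 5` (`cStar_bRec_le_five'`, PathWeightProfile), so the node's value is
  exactly (CV)'s `min(1,⌊25n/p⌋) − N_p` = the landed `recordRayCV_holds` (RecordRayDominanceProof);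
* `14n < p < 15n` (`pathAccounting_bRec_cellA`): `C⋆ ≤ 6` (`cStar_bRec_le_six`), `N_p = 6`, so the value is `≤ 2 − 6 = −4`, which is the landed digit
  theorem `CellA.recordCellA` (`v_p(Cas₇) ≥ −4 = casLB + 1` on that cell) — here the node is one unit SHARPER than (CV) and still a theorem;
* `13n < p < 14n` (`RecordRay1314.pathAccounting_bRec_cell1314`, imported): every class has `E_x ≥ −4`, so `casLB ≥ −5` and (THEOREM LB)
  `v_p(Cas₇) ≥ −5`; `C⋆ ≤ 8`, `N_p = 9`, value `≤ 1 − 9 + 3 = −5`;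
* `12.5n < p ≤ 13n` (`RecordRay1314.pathAccounting_bRec_cell1213`): `casLB ≥ −7` (RecordRayDominanceProof §1), `C⋆ ≤ 9`, `N_p = 12`, value `≤ −7`;
* `12n < p < 12.5n` (`pathAccounting_bRec_cellB`): `⌊d/p⌋ = 2`, `N_p = 12`, `C⋆ ≤ 9`, value `≤ 2 − 12 + 4 = −6` = the landed atlas cell
  `AtlasCellRecB.holds : CellAtlas.RecordCellB` (`v ≥ −6 = casLB + 1`, a digit-bonus cell: PATH is again one unit sharper than the class bound);
* `11n < p < 12n` (`RecordRay1112.pathAccounting_bRec_cell1112`, imported): every class has `E_x ≥ −5` ⇒ `casLB ≥ −7` (sharp) ⇒ `v ≥ −7`;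
  `N_p = 15`, `C⋆ ≤ 11`, value `≤ 2 − 15 + 6 = −7`;
* `10n < p ≤ 11n` and `9n < p ≤ 10n` (`RecordRay1011.pathAccounting_bRec_cell1011`, `RecordRay0910.pathAccounting_bRec_cell0910`): every class has
  `E_x ≥ −6`, resp. `≥ −7` (four- and five-point classes) ⇒ `casLB ≥ −9`, resp. `−11` (sharp) ⇒ `v ≥ −9, −11`; `N_p = 17, 19`, `C⋆ ≤ 11`,
  value `≤ −9, −11`;
* `41n < p` (`pathAccounting_bRec_gt41`): classes are singletons, `casLB ≥ 0`, `⌊d/p⌋ = N_p = 0`, `C⋆ ≤ 5`, value `0`;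
* assembled: `pathAccounting_bRec` (every prime `9n < p ≤ 41n`), `pathAccountingFirstPeriod_bRec` (the node's own hypotheses: `FirstPeriod (bRec n) p`
  in place of `9n < p`, no upper bound on `p`) and `pathAccountingFirstPeriod_holds_on_bRec` (the node's binders verbatim with `b := bRec n`).
Also here: `cv_bRec_all` / `casoratianValuationLaw_on_bRec` — (CV) without the cap `p ≤ 41n` (the node `CasoratianValuationLaw` with `b := bRec n`,
binders verbatim).  So on the record ray the PATH ACCOUNTING node is a THEOREM for every `n`: its value there is `casLB` (THEOREM LB) except on the two digit-bonus cells
`(12n,12.5n)`, `(14n,15n)` where it is `casLB + 1` and the landed atlas/digit theorems supply the extra unit.  Integer bookkeeping + landed theorems; nothing about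
irrationality.
-/

open Finset

namespace Summit.KontsevichZagierPeriods.Zeta5Search.DenomLaw.FirstPeriodKit

open Summit.KontsevichZagierPeriods.Zeta5Search.ClusterValuation
open Summit.KontsevichZagierPeriods.Zeta5Search.CasoratianValuation (InPolytope pairFloors refund shift casoratian)
open Summit.KontsevichZagierPeriods.Zeta5Search.WedgeDictionary (dOf)
open Summit.KontsevichZagierPeriods.Zeta5Search.DenomLaw (cStar)
open Summit.KontsevichZagierPeriods.Zeta5Search.RecordRay1314 (dOf_bRec_div_le_one pathAccounting_bRec_cell1314 pathAccounting_bRec_cell1213)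
open Summit.KontsevichZagierPeriods.Zeta5Search.RecordRay1112 (pathAccounting_bRec_cell1112)
open Summit.KontsevichZagierPeriods.Zeta5Search.RecordRay1011 (pathAccounting_bRec_cell1011)
open Summit.KontsevichZagierPeriods.Zeta5Search.RecordRay0910 (pathAccounting_bRec_cell0910)
open Summit.KontsevichZagierPeriods.Zeta5Search.DenomLaw (FirstPeriod Sorted7)

/-- **PATH on the record ray, `15n < p ≤ 41n`**: `C⋆ ≤ 5` and `⌊d/p⌋ ≤ 1`, so the node's value is (CV)'s, supplied by `recordRayCV_holds`. -/
theorem pathAccounting_bRec_of_gt15 (n p : ℕ) (hn : 1 ≤ n) (hprime : p.Prime) (hp15 : 15 * n < p) (hp41 : p ≤ 41 * n)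
    (hwin : (41 * n + 2 : ℤ) < (p : ℤ) ^ 2) (hcas : casoratian (bRec n) 7 ≠ 0) :
    dOf (bRec n) / (p : ℤ) - pairFloors (bRec n) p
        - min (if 2 ≤ dOf (bRec n) / (p : ℤ) then (1 : ℤ) else 0) (5 - (cStar (bRec n) p : ℤ))
      ≤ padicValRat p (casoratian (bRec n) 7) := by
  have hcv := recordRayCV_holds n 7 p hn (by norm_num) (by norm_num) hprime (by omega) hp41 hwin hcas
  have hC : (cStar (bRec n) p : ℤ) ≤ 5 := by exact_mod_cast cStar_bRec_le_five' hp15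
  have hfd := dOf_bRec_div_le_one (n := n) (p := p) (by omega)
  have href : refund (bRec n) p = dOf (bRec n) / (p : ℤ) := by
    unfold refund; exact min_eq_right hfd
  rw [if_neg (by omega), min_eq_left (by linarith), href.symm]
  linarith

/-- **PATH on the record cell `14n < p < 15n`**: `C⋆ ≤ 6`, `⌊d/p⌋ = 1`, `N_p = 6`, so the node's value is `≤ −4 = casLB + 1`, which is the landed
digit theorem `CellA.recordCellA`. -/
theorem pathAccounting_bRec_cellA (n p : ℕ) (hprime : p.Prime) (hp14 : 14 * n < p) (hp15 : p < 15 * n)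
    (hcas : casoratian (bRec n) 7 ≠ 0) :
    dOf (bRec n) / (p : ℤ) - pairFloors (bRec n) p
        - min (if 2 ≤ dOf (bRec n) / (p : ℤ) then (1 : ℤ) else 0) (5 - (cStar (bRec n) p : ℤ))
      ≤ padicValRat p (casoratian (bRec n) 7) := by
  have hp2 := hprime.two_le
  have hn2 : 2 ≤ n := by
    -- `n = 1` would put the prime `p` at `15` (`14 < p < 15`): impossible; `n = 0` is excluded by `14n < p < 15n`
    rcases Nat.lt_or_ge n 2 with h | h
    · interval_cases n <;> omega
    · exact h
  have hv := CellA.recordCellA n p hn2 hprime hp14 hp15 hcas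
  have hC : (cStar (bRec n) p : ℤ) ≤ 6 := by exact_mod_cast cStar_bRec_le_six hp14
  have hfd := dOf_bRec_div_le_one (n := n) (p := p) (by omega)
  have hN : pairFloors (bRec n) p = 6 := by
    rw [RecordRayMid14.pairFloors_bRec_mid (by omega), if_neg (by omega), if_neg (by omega), if_pos (by omega), if_pos (by omega),
      if_pos (by omega), if_pos (by omega)]
    norm_num
  rw [if_neg (by omega), hN]
  have hmin : -1 ≤ min (0 : ℤ) (5 - (cStar (bRec n) p : ℤ)) := le_min (by norm_num) (by linarith)
  linarith

/-- **PATH on the record cell `12n < p < 12.5n`** (the first `⌊d/p⌋ = 2` cell): `N_p = 12`, `C⋆ ≤ 9`, so the node's value is `≤ 2 − 12 + 4 = −6`,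
which is the landed atlas cell `CellAtlas.RecordCellB` (`AtlasCellRecB.holds`; `n ≥ 2` is automatic). -/
theorem pathAccounting_bRec_cellB (n p : ℕ) (hprime : p.Prime) (hp12 : 12 * n < p) (hp25 : 2 * p < 25 * n)
    (hcas : casoratian (bRec n) 7 ≠ 0) :
    dOf (bRec n) / (p : ℤ) - pairFloors (bRec n) p
        - min (if 2 ≤ dOf (bRec n) / (p : ℤ) then (1 : ℤ) else 0) (5 - (cStar (bRec n) p : ℤ))
      ≤ padicValRat p (casoratian (bRec n) 7) := by
  have hp2 := hprime.two_le
  have hn2 : 2 ≤ n := by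
    rcases Nat.lt_or_ge n 2 with h | h
    · interval_cases n <;> omega
    · exact h
  have hv := AtlasCellRecB.holds n p hn2 hprime hp12 hp25 hcas
  have hC : (cStar (bRec n) p : ℤ) ≤ 9 := by exact_mod_cast RecordRay1314.cStar_bRec_le_nine hp12
  have hp0 : (0 : ℤ) < p := by exact_mod_cast hprime.pos
  have hfd : dOf (bRec n) / (p : ℤ) = 2 := by
    rw [dOf_bRec]
    apply le_antisymm
    · have : (25 * (n : ℤ)) / (p : ℤ) < 3 := by rw [Int.ediv_lt_iff_lt_mul hp0]; omega
      omega
    · rw [Int.le_ediv_iff_mul_le hp0]; omega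
  have hN : pairFloors (bRec n) p = 12 := by
    rw [RecordRayMid14.pairFloors_bRec_mid (by omega), if_pos (by omega), if_pos (by omega), if_pos (by omega), if_pos (by omega),
      if_pos (by omega), if_pos (by omega)]
    norm_num
  rw [hfd, if_pos (le_refl _), hN]
  have hmin : -4 ≤ min (1 : ℤ) (5 - (cStar (bRec n) p : ℤ)) := le_min (by norm_num) (by linarith)
  linarith

/-- **`PathAccountingFirstPeriod` ON THE RECORD RAY for every prime `9n < p ≤ 41n` (with the node's window `p² > 41n + 2`), all `n ≥ 1`.** -/
theorem pathAccounting_bRec (n p : ℕ) (hn : 1 ≤ n) (hprime : p.Prime) (hp9 : 9 * n < p) (hp41 : p ≤ 41 * n)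
    (hwin : (41 * n + 2 : ℤ) < (p : ℤ) ^ 2) (hcas : casoratian (bRec n) 7 ≠ 0) :
    dOf (bRec n) / (p : ℤ) - pairFloors (bRec n) p
        - min (if 2 ≤ dOf (bRec n) / (p : ℤ) then (1 : ℤ) else 0) (5 - (cStar (bRec n) p : ℤ))
      ≤ padicValRat p (casoratian (bRec n) 7) := by
  rcases Nat.lt_or_ge (10 * n) p with h10 | h10
  swap
  · exact pathAccounting_bRec_cell0910 n p hn hprime hp9 h10 hwin hcas
  rcases Nat.lt_or_ge (11 * n) p with hp11 | hp11
  swap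
  · exact pathAccounting_bRec_cell1011 n p hn hprime h10 hp11 hwin hcas
  rcases Nat.lt_or_ge p (12 * n) with h12 | h12
  · exact pathAccounting_bRec_cell1112 n p hn hprime hp11 h12 hwin hcas
  have hne12 : p ≠ 12 * n := fun h => by
    have := hprime.eq_one_or_self_of_dvd 2 ⟨6 * n, by omega⟩; omega
  have hp12 : 12 * n < p := by omega
  rcases Nat.lt_or_ge (2 * p) (25 * n) with hp25 | hp25
  · exact pathAccounting_bRec_cellB n p hprime hp12 hp25 hcas
  have hp25' : 25 * n < 2 * p := by
    rcases Nat.lt_or_ge (25 * n) (2 * p) with h | h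
    · exact h
    · exfalso
      have h2 : 2 * p = 25 * n := le_antisymm (by omega) hp25
      have : (2 : ℕ) ∣ 25 * n := ⟨p, by omega⟩
      have h5 : (2 : ℕ) ∣ n := by
        rcases (Nat.Prime.dvd_mul Nat.prime_two).1 this with h | h
        · norm_num at h
        · exact h
      obtain ⟨m, rfl⟩ := h5
      have hpm : p = 25 * m := by omega
      have := hprime.eq_one_or_self_of_dvd 5 ⟨5 * m, by omega⟩
      omega
  rcases Nat.lt_or_ge (13 * n) p with hp13 | hp13
  swap
  · exact pathAccounting_bRec_cell1213 n p hn hprime hp25' hp13 hwin hcas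
  rcases Nat.lt_or_ge p (14 * n) with h14 | h14
  · exact pathAccounting_bRec_cell1314 n p hn hprime hp13 h14 hwin hcas
  have hne14 : p ≠ 14 * n := prime_ne_mul hprime (by omega) (Or.inl rfl)
  rcases Nat.lt_or_ge p (15 * n) with h15 | h15
  · exact pathAccounting_bRec_cellA n p hprime (by omega) h15 hcas
  · have hne : p ≠ 15 * n := prime_ne_mul hprime (by omega) (Or.inr (Or.inl rfl))
    exact pathAccounting_bRec_of_gt15 n p hn hprime (by omega) hp41 hwin hcas

/-- On the record ray the node's hypothesis `FirstPeriod` forces `9n < p` (the pair block `41n − 12n − 11n = 18n` is `< 2p`). -/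
theorem nine_lt_of_firstPeriod {n p : ℕ} (h : FirstPeriod (bRec n) p) : 9 * n < p := by
  have := h.2 5 (by simp) 6 (by simp) (by norm_num)
  simp [bRec] at this
  omega

/-- Beyond the ray's support (`p > 41n = b₀`) every class is at most the singleton `{x}`: a pole class is a tame single pole (`ν ≥ 0`), there is
no multipole class and `p > d`, so `casLB(b(n),p) ≥ 0`. -/
theorem casLB_bRec_nonneg_gt41 {n p : ℕ} (hp : 41 * n < p) : 0 ≤ casLB (bRec n) p := by
  have hsub : ∀ x, x < p → ∀ s ∈ classSet (bRec n) p x, s = x := by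
    intro x hx s hs
    rw [mem_classSet_iff, CellA.bRec_zero_toNat] at hs
    obtain ⟨hs41, k, hk⟩ := hs
    have hk0 : 0 ≤ k := by
      by_contra hneg
      push Not at hneg
      have : (p : ℤ) * k ≤ (p : ℤ) * (-1) := mul_le_mul_of_nonneg_left (by omega) (by omega)
      omega
    have hk1 : k < 1 := by
      by_contra hge
      push Not at hge
      have : (p : ℤ) * 1 ≤ (p : ℤ) * k := mul_le_mul_of_nonneg_left hge (by omega)
      omega
    interval_cases k
    omega
  have hle : ∀ x, x < p → classPoleCount (bRec n) p x ≤ 1 := by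
    intro x hx
    unfold classPoleCount
    calc ((classSet (bRec n) p x).filter fun s => netExp (bRec n) s < 0).card ≤ ({x} : Finset ℕ).card :=
          card_le_card fun s hs => mem_singleton.2 (hsub x hx s (mem_filter.1 hs).1)
      _ = 1 := card_singleton x
  have hA : ∀ x, x < p → 1 ≤ classPoleCount (bRec n) p x → (0 : ℤ) ≤ classNu (bRec n) p x := by
    intro x hx h1
    have hc : classPoleCount (bRec n) p x = 1 := le_antisymm (hle x hx) h1
    obtain ⟨s, hs⟩ : ((classSet (bRec n) p x).filter fun s => netExp (bRec n) s < 0).Nonempty := by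
      rw [← card_pos]; unfold classPoleCount at h1; exact h1
    obtain ⟨hsx, hneg⟩ := mem_filter.1 hs
    obtain rfl := hsub x hx s hsx
    have htm : tameSingle (bRec n) p s = true := by
      rw [tameSingle_iff]; exact ⟨s, hsx, hneg, Or.inl hx⟩
    unfold classNu; rw [if_pos ⟨hc, htm⟩]; exact le_max_right _ _
  rcases casLB_ge_or_noPole (bRec n) p 0 0 hA (by norm_num) (fun x hx h2 => absurd (hle x hx) (by omega)) (fun _ => le_rfl)
    with ⟨h0, -⟩ | h
  · rw [h0]
  · linarith

/-- **PATH beyond the ray's support (`41n < p`)**: `⌊d/p⌋ = 0`, `N_p = 0`, `C⋆ ≤ 5`, value `0 ≤ casLB ≤ v_p(Cas₇)`. -/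
theorem pathAccounting_bRec_gt41 (n p : ℕ) (hn : 1 ≤ n) (hprime : p.Prime) (hp : 41 * n < p) (hcas : casoratian (bRec n) 7 ≠ 0) :
    dOf (bRec n) / (p : ℤ) - pairFloors (bRec n) p
        - min (if 2 ≤ dOf (bRec n) / (p : ℤ) then (1 : ℤ) else 0) (5 - (cStar (bRec n) p : ℤ))
      ≤ padicValRat p (casoratian (bRec n) 7) := by
  have hb0 : (bRec n 0 + 2 : ℤ) < (p : ℤ) ^ 2 := by
    rw [CellA.bRec_zero]
    have h1 : (41 * n + 1 : ℤ) ≤ p := by exact_mod_cast (show 41 * n + 1 ≤ p by omega)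
    have hn1 : (1 : ℤ) ≤ n := by exact_mod_cast hn
    nlinarith
  have hLB := casoratianClassBound_holds (bRec n) 7 p (inPolytope_bRec n) (by norm_num) (by norm_num)
    (inPolytope_shift_bRec n 7 hn (by norm_num) (by norm_num)) hprime (by omega) hb0 hcas
  have h0 := casLB_bRec_nonneg_gt41 (n := n) (p := p) hp
  have hC : (cStar (bRec n) p : ℤ) ≤ 5 := by exact_mod_cast cStar_bRec_le_five' (n := n) (p := p) (by omega)
  have hfd : dOf (bRec n) / (p : ℤ) = 0 := by
    rw [dOf_bRec]; exact Int.ediv_eq_zero_of_lt (by positivity) (by omega)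
  have hN : pairFloors (bRec n) p = 0 := by
    rw [RecordRayMid14.pairFloors_bRec_mid (by omega), if_neg (by omega), if_neg (by omega), if_neg (by omega), if_neg (by omega),
      if_neg (by omega), if_neg (by omega)]
    norm_num
  rw [hfd, hN, if_neg (by norm_num), min_eq_left (by linarith)]
  linarith

/-- **`PathAccountingFirstPeriod` ON THE RECORD RAY, in the node's own hypotheses** (`FirstPeriod (bRec n) p`, the window `b₀ + 2 < p²`), all `n ≥ 1`:
the node's `InPolytope` / `Sorted7` / `InPolytope (shift b 7)` / `5 ≤ p` hypotheses are automatic on the ray and not even needed. -/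
theorem pathAccountingFirstPeriod_bRec (n p : ℕ) (hn : 1 ≤ n) (hprime : p.Prime)
    (hwin : (bRec n 0 + 2 : ℤ) < (p : ℤ) ^ 2) (hfp : FirstPeriod (bRec n) p) (hcas : casoratian (bRec n) 7 ≠ 0) :
    dOf (bRec n) / (p : ℤ) - pairFloors (bRec n) p
        - min (if 2 ≤ dOf (bRec n) / (p : ℤ) then (1 : ℤ) else 0) (5 - (cStar (bRec n) p : ℤ))
      ≤ padicValRat p (casoratian (bRec n) 7) := by
  rcases Nat.lt_or_ge (41 * n) p with h41 | h41
  · exact pathAccounting_bRec_gt41 n p hn hprime h41 hcas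
  rw [CellA.bRec_zero] at hwin
  exact pathAccounting_bRec n p hn hprime (nine_lt_of_firstPeriod hfp) h41 (by exact_mod_cast hwin) hcas

/-- **The node `PathAccountingFirstPeriod` restricted to the record ray**, literally (all its hypotheses, `b := bRec n`). -/
theorem pathAccountingFirstPeriod_holds_on_bRec (n p : ℕ) (hn : 1 ≤ n) :
    InPolytope (bRec n) → Sorted7 (bRec n) → InPolytope (shift (bRec n) 7) →
    p.Prime → 5 ≤ p → (bRec n 0 + 2 : ℤ) < (p : ℤ) ^ 2 → FirstPeriod (bRec n) p → casoratian (bRec n) 7 ≠ 0 →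
      dOf (bRec n) / (p : ℤ) - pairFloors (bRec n) p - min (if 2 ≤ dOf (bRec n) / (p : ℤ) then (1 : ℤ) else 0) (5 - (cStar (bRec n) p : ℤ))
        ≤ padicValRat p (casoratian (bRec n) 7) :=
  fun _ _ _ hprime _ hwin hfp hcas => pathAccountingFirstPeriod_bRec n p hn hprime hwin hfp hcas

/-! ## (CV) on the ray without the cap `p ≤ 41n` -/

/-- **(CV) = `CasoratianValuationLaw`'s literal conclusion ON THE RECORD RAY for every window prime, all `n ≥ 1`** (the landed `recordRayCV_holds`
for `p ≤ 41n`; beyond `41n` the classes are singletons, `casLB ≥ 0 = refund − N_p`). -/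
theorem cv_bRec_all (n j p : ℕ) (hn : 1 ≤ n) (hj1 : 1 ≤ j) (hj7 : j ≤ 7) (hprime : p.Prime) (hp5 : 5 ≤ p)
    (hwin : (41 * n + 2 : ℤ) < (p : ℤ) ^ 2) (hcas : casoratian (bRec n) j ≠ 0) :
    refund (bRec n) p - pairFloors (bRec n) p ≤ padicValRat p (casoratian (bRec n) j) := by
  rcases Nat.lt_or_ge (41 * n) p with h41 | h41
  · have hb0 : (bRec n 0 + 2 : ℤ) < (p : ℤ) ^ 2 := by rw [CellA.bRec_zero]; exact_mod_cast hwin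
    have hLB := casoratianClassBound_holds (bRec n) j p (inPolytope_bRec n) hj1 hj7
      (inPolytope_shift_bRec n j hn hj1 hj7) hprime hp5 hb0 hcas
    have h0 := casLB_bRec_nonneg_gt41 (n := n) (p := p) h41
    rw [RecordRayMid14.refund_bRec_eq_zero (by omega), RecordRayMid14.pairFloors_bRec_mid (by omega), if_neg (by omega), if_neg (by omega),
      if_neg (by omega), if_neg (by omega), if_neg (by omega), if_neg (by omega)]
    norm_num
    linarith
  · exact recordRayCV_holds n j p hn hj1 hj7 hprime hp5 h41 hwin hcas

/-- **The node `CasoratianValuationLaw` restricted to the record ray**, binders verbatim with `b := bRec n`. -/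
theorem casoratianValuationLaw_on_bRec (n j p : ℕ) (hn : 1 ≤ n) :
    InPolytope (bRec n) → 1 ≤ j → j ≤ 7 → InPolytope (shift (bRec n) j) →
    p.Prime → 5 ≤ p → (bRec n 0 + 2 : ℤ) < (p : ℤ) ^ 2 → casoratian (bRec n) j ≠ 0 →
      refund (bRec n) p - pairFloors (bRec n) p ≤ padicValRat p (casoratian (bRec n) j) := by
  intro _ hj1 hj7 _ hprime hp5 hwin hcas
  rw [CellA.bRec_zero] at hwin
  exact cv_bRec_all n j p hn hj1 hj7 hprime hp5 (by exact_mod_cast hwin) hcas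

end Summit.KontsevichZagierPeriods.Zeta5Search.DenomLaw.FirstPeriodKit
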